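import Summits.QuantumFields.YangMills.Theorems.BalabanUVNodesN11NoExpansionStepReductionIntegrableCoPH
import Summits.QuantumFields.YangMills.Theorems.BalabanUVNodesN11RePinnedParamDefs

/-!
# DAG node N11 — THEOREM 1's INDUCTIVE STEP AT THE RE-PINNED v1.7 PARAMETER `rePinH θ` REDUCED TO THE EXPANSION SEQUENCES, INTEGRABLE FORM: `TLaw₁₃CoPH (rePinH θ) p k` and,
# on the live-selector line, `SLaw₁₃CoPH (rePinH θ) p (k+1)` from the §2 form of `ρ_k` there, a candidate family serving the expansion sequences, the new universal 𝐄-terms'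
# clauses, `hA`, and the old-branch rows measurability `hmB` ∕ INTEGRABILITY `hIB` — the residual-slot binder families (P)∕(V)∕`hq`∕`hqloc` GONE and the sup bound `hCB` RE-TYPED

Cell `pub-ymgap`, YM-PLAN Track A (HUMAN RULING D-0062), seat `pub-ymgap-dag-n11-e` (g13; R134 fan-out row N11∕s3), route `BalabanUVNodes` rev 25 (v1.7 `CoPH` key), item K1⁷
`StabilityBAtRecordR13SepCoPH` = stmt-QuantumFields-20542 (helper lane, count-neutral).  [III] = [Balaban1988Convergent], [IV] = [Balaban1989LargeFieldI].  The integrable edition of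
this seat's `…NoExpansionStepReductionRePinnedCoPH` (p556012) over `…NoExpansionStepReductionIntegrableCoPH` and dag-n11-d's `…N11RePinnedParamDefs` (p552185).

WHY THIS FILE.  p556012 states Theorem 1's step at `rePinH θ` modulo `hexp` + the new 𝐄-terms' clauses + `hA` + `hmB` ∕ `hCB`, where `hCB` (a sup bound on the old branch uniform in
the field) is dag-n11-d's located mis-typed row — it runs through `margDensity` of the exp-mean-log averaging, for which the tree has absolute continuity only.  dag-n11-d re-typed
the no-expansion chain to integrability (`…NoExpansionOldBranchIntegrable`), this seat carried it through the reduction (`…StepReductionIntegrableCoPH`); at `rePinH θ` the four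
residual-slot binder families are theorems (`prefix_agree_rePinH`, `zhAt_rePinH_ζ0_univ_pairCfgAt`, `quad ≡ 0`) and def-T's core provisos transfer (`provisos₁₃CoPH_rePinH`).
HENCE ★★★ `tLaw₁₃CoPH_rePinH_of_formAtZS_of_newTerms_of_expansion_of_integrable` · ★★★ `sLaw₁₃CoPH_rePinH_succ_of_formAtZS_of_newTerms_of_expansion_of_liveSel_of_integrable` —
the HONEST LIST of what Theorem 1's inductive step `ρ_k ↦ ρ_{k+1}` still needs off the diagonal, at a named parameter: `hexp` ([III] §3 at `Ω_{k+1} ≠ ∅`), the new universal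
𝐄-terms' r11 clauses, the old action's fluctuation-locality `hA`, measurability `hmB` (= measurability of the operand at `rePinH θ`, dag-n11-d `…RePinnedOldBranchMeasurable`: a
measurability law for `Sect2.TermValues`, not in the tree) and integrability `hIB` of the old branch.

HONEST FRAMING.  Count-neutral kernel bookkeeping — ONE application each at the NAMED tree term `rePinH θ`; `hexp` is DISPLAYED, not proved; the certificate family is NOT H3's
value of record; nothing of Bałaban asserted; N11 NOT discharged; K1⁷ NOT closed; counts unmoved (typed 28∕28 · discharged 5∕27).  One finite `𝕋⁴_{L^K}` programme at fixed
`ε = L^{−K}`; NOT ℝ⁴, NOT OS, NOT a mass gap, NOT Clay.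
Sources: [III] Theorem p.245, Thm 1 p.262, §2 p.262, (2.17)–(2.18) p.257, (2.20)–(2.31) pp.258–260, (2.40)–(2.42) p.261, (3.1) p.264, (3.16)–(3.20) pp.268–269, (3.24)–(3.25)
p.270, p.279; [IV] (0.2)–(0.4) p.176, p.177 (i)–(ii); [Balaban1987RG1] (0.20) p.256.
-/

noncomputable section

open MeasureTheory
open scoped BigOperators Matrix.Norms.L2Operator

namespace Summit.QuantumFields.YangMills.Theorems.BalabanUVNodesN11NoExpansionStepReductionRePinnedIntegrableCoPH

open Literature.MathematicalPhysics.QuantumFieldTheory.Balaban1983to89 T4Continuum Node00 Node00.Tk DagBinding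
open BalabanUVNodesN11RePinnedParamDefs (rePinH provisos₁₃CoPH_rePinH prefix_agree_rePinH zhAt_rePinH_ζ0_univ_pairCfgAt)
open BalabanUVNodesN11NoExpansionStepReductionIntegrableCoPH (tLaw₁₃CoPH_of_formAtZS_of_newTerms_of_expansion_of_integrable
  sLaw₁₃CoPH_succ_of_formAtZS_of_newTerms_of_expansion_of_liveSel_of_integrable)

section Reduction

variable {F : T4Family} {N : ℕ} [NeZero N]
variable (θ : Stage13HParams F N) (p : B12.RunParams)

/-- **★★★ `TLaw₁₃CoPH (rePinH θ) p k` REDUCED TO THE EXPANSION SEQUENCES, INTEGRABLE FORM, with NO residual-slot hypothesis** (this seat's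
`tLaw₁₃CoPH_of_formAtZS_of_newTerms_of_expansion_of_integrable` at `θ := rePinH θ` — old-branch rows `hmB` ∕ `hIB`; the binder families `hqloc`, `hpre`, `hZ`, `hq` there are dag-n11-d's
`zhAt_rePinH_quad` (`rfl`), `prefix_agree_rePinH`, `zhAt_rePinH_ζ0_univ_pairCfgAt`, `rfl`).  See the module header for the hypothesis list.
[cite: Balaban1988Convergent, Theorem p.245, Thm 1 p.262, §2 p.262, (3.24)–(3.25) p.270, (2.18) p.257, (2.20)–(2.31) pp.258–260, (2.40)–(2.42) p.261, (3.16)–(3.20) pp.268–269, p.279; Balaban1989LargeFieldI, (0.2)–(0.3) p.176; Balaban1987RG1, (0.20) p.256] -/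
theorem tLaw₁₃CoPH_rePinH_of_formAtZS_of_newTerms_of_expansion_of_integrable (h : θ.Provisos₁₃CoPH F N) {k : ℕ} (hk : k < p.K) (hM : 1 ≤ θ.τ9.M) (hB₀ : 0 ≤ θ.s2.lf.B₀)
    (t : SeqOfRecord F θ.ν θ.τ9.M (gOfRecord₁₃ F N θ.toStage13Params p) p.K k → Sect2.TermValues (F.P p.K) (MatA N) (FluctV N) θ.τ9.M)
    (Ek : SeqOfRecord F θ.ν θ.τ9.M (gOfRecord₁₃ F N θ.toStage13Params p) p.K k → ℝ)
    (hS : HasSect2FormAtZS F N (FluctV N) p.K (settingOfRecord₁₃ F N θ.toStage13Params p) k (θ.rzAt p) (WtOfRecord₁₃H F N (rePinH θ) p)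
      (UbgOfRecord₁₃CoP F N θ.toStage13Params p k)
      (fun s u => Sect2.LawsRT (sect2TowerOfRecord F N (FluctV N) p.K (settingOfRecord₁₃ F N θ.toStage13Params p) (θ.rzAt p s) s u)
        (settingOfRecord₁₃ F N θ.toStage13Params p).lf k)
      (slotsOfRecord F N θ.ν θ.τ9 (EOfRecord₁₃ F N θ.toStage13Params) (wOfRecord₉ F N θ.toStage9Params) θ.ppSel p (gOfRecord₁₃ F N θ.toStage13Params p) k) t Ek)
    (tT : SeqOfRecord F θ.ν θ.τ9.M (gOfRecord₁₃ F N θ.toStage13Params p) p.K (k + 1) → Sect2.TermValues (F.P p.K) (MatA N) (FluctV N) θ.τ9.M)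
    (EkT : SeqOfRecord F θ.ν θ.τ9.M (gOfRecord₁₃ F N θ.toStage13Params p) p.K (k + 1) → ℝ) (huT : Sect2.UniversalE tT)
    (hold : ∀ s : SeqOfRecord F θ.ν θ.τ9.M (gOfRecord₁₃ F N θ.toStage13Params p) p.K (k + 1), s.Ω (k + 1) = ∅ →
      (∀ j, j ≤ k → ∀ X z g φ, (tT s).E j X z g φ = (t s.init).E j X z g φ) ∧ (∀ j, j ≤ k → ∀ X φ, (tT s).R j X φ = (t s.init).R j X φ) ∧
        (∀ j, j ≤ k → ∀ X φ a, (tT s).B j X φ a = (t s.init).B j X φ a))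
    (hnoR : ∀ s : SeqOfRecord F θ.ν θ.τ9.M (gOfRecord₁₃ F N θ.toStage13Params p) p.K (k + 1), s.Ω (k + 1) = ∅ → ∀ X φ, (tT s).R (k + 1) X φ = 0)
    (hnoB : ∀ s : SeqOfRecord F θ.ν θ.τ9.M (gOfRecord₁₃ F N θ.toStage13Params p) p.K (k + 1), s.Ω (k + 1) = ∅ → ∀ X φ a, (tT s).B (k + 1) X φ a = 0)
    (hlocE : ∀ s : SeqOfRecord F θ.ν θ.τ9.M (gOfRecord₁₃ F N θ.toStage13Params p) p.K (k + 1), s.Ω (k + 1) = ∅ → ∀ X z g φ ψ,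
      (sect2TowerOfRecord F N (FluctV N) p.K (settingOfRecord₁₃ F N θ.toStage13Params p) (θ.rzAt p s) s (tT s)).agreeOn (k + 1) X φ ψ →
        (tT s).E (k + 1) X z g φ = (tT s).E (k + 1) X z g ψ)
    (hinvE : ∀ s : SeqOfRecord F θ.ν θ.τ9.M (gOfRecord₁₃ F N θ.toStage13Params p) p.K (k + 1), s.Ω (k + 1) = ∅ → ∀ X z g u φ,
      (tT s).E (k + 1) X z g ((sect2TowerOfRecord F N (FluctV N) p.K (settingOfRecord₁₃ F N θ.toStage13Params p) (θ.rzAt p s) s (tT s)).act u φ) = (tT s).E (k + 1) X z g φ)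
    (hbdE : ∀ s : SeqOfRecord F θ.ν θ.τ9.M (gOfRecord₁₃ F N θ.toStage13Params p) p.K (k + 1), s.Ω (k + 1) = ∅ → ∀ X z g φ, 0 ≤ g →
      g ≤ (settingOfRecord₁₃ F N θ.toStage13Params p).lf.γ →
      φ ∈ (sect2TowerOfRecord F N (FluctV N) p.K (settingOfRecord₁₃ F N θ.toStage13Params p) (θ.rzAt p s) s (tT s)).space (k + 1) X
        ((settingOfRecord₁₃ F N θ.toStage13Params p).lf.alpha0 ((settingOfRecord₁₃ F N θ.toStage13Params p).flow.g (k + 1)))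
        ((settingOfRecord₁₃ F N θ.toStage13Params p).lf.alpha1 ((settingOfRecord₁₃ F N θ.toStage13Params p).flow.g (k + 1))) →
      ‖(tT s).E (k + 1) X z g φ‖ ≤ (settingOfRecord₁₃ F N θ.toStage13Params p).lf.E₀ *
        Real.exp (-((1 + 4 * (settingOfRecord₁₃ F N θ.toStage13Params p).βc) * (settingOfRecord₁₃ F N θ.toStage13Params p).lf.κ) *
          (Sect2.domSys (F.P p.K) θ.τ9.M (k + 1)).dj X))
    (hanE : ∀ s : SeqOfRecord F θ.ν θ.τ9.M (gOfRecord₁₃ F N θ.toStage13Params p) p.K (k + 1), s.Ω (k + 1) = ∅ → ∀ X z g, 0 ≤ g →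
      g ≤ (settingOfRecord₁₃ F N θ.toStage13Params p).lf.γ →
      AnalyticOnNhd ℂ ((tT s).E (k + 1) X z g)
        ((sect2TowerOfRecord F N (FluctV N) p.K (settingOfRecord₁₃ F N θ.toStage13Params p) (θ.rzAt p s) s (tT s)).space (k + 1) X
          ((settingOfRecord₁₃ F N θ.toStage13Params p).lf.alpha0 ((settingOfRecord₁₃ F N θ.toStage13Params p).flow.g (k + 1)))
          ((settingOfRecord₁₃ F N θ.toStage13Params p).lf.alpha1 ((settingOfRecord₁₃ F N θ.toStage13Params p).flow.g (k + 1)))))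
    (hEk : ∀ s : SeqOfRecord F θ.ν θ.τ9.M (gOfRecord₁₃ F N θ.toStage13Params p) p.K (k + 1), s.Ω (k + 1) = ∅ → EkT s = Ek s.init)
    (hA : ∀ s : SeqOfRecord F θ.ν θ.τ9.M (gOfRecord₁₃ F N θ.toStage13Params p) p.K (k + 1), s.Ω (k + 1) = ∅ →
      ∀ (S : ℕ → Set (Site (F.P p.K) 0)) (a a' : Tk.MSFluct (F.P p.K) (FluctV N)) (Uf : GaugeField (F.P p.K) 0 (SU N)), (∀ i, i ≤ k → a i = a' i) →
      (sect2ActionDataOfRecord F N (FluctV N) p.K (settingOfRecord₁₃ F N θ.toStage13Params p) (θ.rzAt p s.init) s.init (t s.init) (S, a) (Ek s.init)).action23 k Uf =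
        (sect2ActionDataOfRecord F N (FluctV N) p.K (settingOfRecord₁₃ F N θ.toStage13Params p) (θ.rzAt p s.init) s.init (t s.init) (S, a') (Ek s.init)).action23 k Uf)
    (hmB : ∀ s : SeqOfRecord F θ.ν θ.τ9.M (gOfRecord₁₃ F N θ.toStage13Params p) p.K (k + 1), s.Ω (k + 1) = ∅ →
      ∀ S ∈ admSOfRecord F θ.ν θ.τ9.M (gOfRecord₁₃ F N θ.toStage13Params p) p.K k s.init,
      Measurable fun U₀ : GaugeField (F.P p.K) k (SU N) =>
        tkBranchOfRecord F N (FluctV N) θ.ν θ.τ9.M _ p.K (WtOfRecord₁₃H F N (rePinH θ) p s) s.init S k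
          (fun ω => sect2Operand F N (FluctV N) p.K (settingOfRecord₁₃ F N θ.toStage13Params p) (θ.rzAt p s.init) s.init (t s.init) (Ek s.init)
            (UbgOfRecord₁₃CoP F N θ.toStage13Params p k s.init) (S, fun j => (ω j).2) (fun j => (ω j).1))
          (baseCfg (V := FluctV N) k U₀))
    (hIB : ∀ s : SeqOfRecord F θ.ν θ.τ9.M (gOfRecord₁₃ F N θ.toStage13Params p) p.K (k + 1), s.Ω (k + 1) = ∅ →
      ∀ S ∈ admSOfRecord F θ.ν θ.τ9.M (gOfRecord₁₃ F N θ.toStage13Params p) p.K k s.init,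
      Integrable (fun U₀ : GaugeField (F.P p.K) k (SU N) =>
        tkBranchOfRecord F N (FluctV N) θ.ν θ.τ9.M _ p.K (WtOfRecord₁₃H F N (rePinH θ) p s) s.init S k
          (fun ω => sect2Operand F N (FluctV N) p.K (settingOfRecord₁₃ F N θ.toStage13Params p) (θ.rzAt p s.init) s.init (t s.init) (Ek s.init)
            (UbgOfRecord₁₃CoP F N θ.toStage13Params p k s.init) (S, fun j => (ω j).2) (fun j => (ω j).1))
          (baseCfg (V := FluctV N) k U₀)) (fieldMeasure (F.P p.K) k (SU N)))
    (hexp : ∀ s : SeqOfRecord F θ.ν θ.τ9.M (gOfRecord₁₃ F N θ.toStage13Params p) p.K (k + 1), s.Ω (k + 1) ≠ ∅ →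
      Sect2.LawsT (sect2TowerOfRecord F N (FluctV N) p.K (settingOfRecord₁₃ F N θ.toStage13Params p) (θ.rzAt p s) s (tT s))
          (settingOfRecord₁₃ F N θ.toStage13Params p).lf (settingOfRecord₁₃ F N θ.toStage13Params p).βc k ∧
        (slotsTOfRecord F N θ.ν θ.τ9 (EOfRecord₁₃ F N θ.toStage13Params) (wOfRecord₉ F N θ.toStage9Params) θ.ppSel p
            (gOfRecord₁₃ F N θ.toStage13Params p) (k + 1) s = 0 ∨
          ∀ᵐ V' ∂fieldMeasure (F.P p.K) (k + 1) (SU N),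
            chiSeqOfRecord F N θ.ν θ.τ9.M (gOfRecord₁₃ F N θ.toStage13Params p) p.K (k + 1) s V' ≠ 0 →
              slotsTOfRecord F N θ.ν θ.τ9 (EOfRecord₁₃ F N θ.toStage13Params) (wOfRecord₉ F N θ.toStage9Params) θ.ppSel p
                  (gOfRecord₁₃ F N θ.toStage13Params p) (k + 1) s V' =
                sect2Slot F N (FluctV N) p.K (settingOfRecord₁₃ F N θ.toStage13Params p) (θ.rzAt p s) (WtOfRecord₁₃H F N (rePinH θ) p s) s (tT s) (EkT s)
                  (UbgOfRecord₁₃CoP F N θ.toStage13Params p (k + 1) s) V')) :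
    TLaw₁₃CoPH F N (rePinH θ) p k :=
  tLaw₁₃CoPH_of_formAtZS_of_newTerms_of_expansion_of_integrable (rePinH θ) p (provisos₁₃CoPH_rePinH h) hk hM hB₀ t Ek hS tT EkT huT hold hnoR hnoB hlocE hinvE hbdE
    hanE hEk (fun _ _ _ _ _ _ _ => rfl) (fun s hΩ => prefix_agree_rePinH θ p s hΩ) hA (fun s hΩ => zhAt_rePinH_ζ0_univ_pairCfgAt θ p hk s hΩ) (fun _ _ _ _ => rfl)
    hmB hIB hexp

/-- **★★★ … HENCE `SLaw₁₃CoPH (rePinH θ) p (k+1)` ON THE LIVE-SELECTOR LINE, INTEGRABLE FORM** — Theorem 1's complete inductive step `ρ_k ↦ ρ_{k+1}` at the re-pinned parameter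
from the same inputs plus node00-def-T's selector clause of `θ`, admissibility and the signs `0 ≤ κ, E₀`.  MODULO EXACTLY: `hexp` (the expansion sequences — [III] §3 proper), the
new universal 𝐄-terms' clauses, `hA`, and the old-branch rows `hmB` (measurability; at `rePinH θ` = measurability of the operand, dag-n11-d `…RePinnedOldBranchMeasurable`) ∕
`hIB` (integrability); NO residual-slot hypothesis — the honest list of what Theorem 1's inductive step still needs off the diagonal.
[cite: Balaban1988Convergent, Thm 1 p.262, Theorem p.245, §2 p.262, (3.24)–(3.25) p.270, (2.17)–(2.18) p.257, (3.16)–(3.20) pp.268–269, p.279; Balaban1989LargeFieldI, (0.2)–(0.4) p.176, p.177 (i)–(ii)] -/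
theorem sLaw₁₃CoPH_rePinH_succ_of_formAtZS_of_newTerms_of_expansion_of_liveSel_of_integrable (h : θ.Provisos₁₃CoPH F N)
    (hsel : θ.ppSel = ppSelLiveOfRecord F N θ.ν θ.τ9 (EOfRecord₁₃ F N θ.toStage13Params) (wOfRecord₉ F N θ.toStage9Params))
    (hθ : θ.Admissible F N) (hκ : 0 ≤ θ.s2.lf.κ) (hE₀ : 0 ≤ θ.s2.lf.E₀) (hB₀ : 0 ≤ θ.s2.lf.B₀) {k : ℕ} (hk : k < p.K) (hM : 1 ≤ θ.τ9.M)
    (t : SeqOfRecord F θ.ν θ.τ9.M (gOfRecord₁₃ F N θ.toStage13Params p) p.K k → Sect2.TermValues (F.P p.K) (MatA N) (FluctV N) θ.τ9.M)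
    (Ek : SeqOfRecord F θ.ν θ.τ9.M (gOfRecord₁₃ F N θ.toStage13Params p) p.K k → ℝ)
    (hS : HasSect2FormAtZS F N (FluctV N) p.K (settingOfRecord₁₃ F N θ.toStage13Params p) k (θ.rzAt p) (WtOfRecord₁₃H F N (rePinH θ) p)
      (UbgOfRecord₁₃CoP F N θ.toStage13Params p k)
      (fun s u => Sect2.LawsRT (sect2TowerOfRecord F N (FluctV N) p.K (settingOfRecord₁₃ F N θ.toStage13Params p) (θ.rzAt p s) s u)
        (settingOfRecord₁₃ F N θ.toStage13Params p).lf k)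
      (slotsOfRecord F N θ.ν θ.τ9 (EOfRecord₁₃ F N θ.toStage13Params) (wOfRecord₉ F N θ.toStage9Params) θ.ppSel p (gOfRecord₁₃ F N θ.toStage13Params p) k) t Ek)
    (tT : SeqOfRecord F θ.ν θ.τ9.M (gOfRecord₁₃ F N θ.toStage13Params p) p.K (k + 1) → Sect2.TermValues (F.P p.K) (MatA N) (FluctV N) θ.τ9.M)
    (EkT : SeqOfRecord F θ.ν θ.τ9.M (gOfRecord₁₃ F N θ.toStage13Params p) p.K (k + 1) → ℝ) (huT : Sect2.UniversalE tT)
    (hold : ∀ s : SeqOfRecord F θ.ν θ.τ9.M (gOfRecord₁₃ F N θ.toStage13Params p) p.K (k + 1), s.Ω (k + 1) = ∅ →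
      (∀ j, j ≤ k → ∀ X z g φ, (tT s).E j X z g φ = (t s.init).E j X z g φ) ∧ (∀ j, j ≤ k → ∀ X φ, (tT s).R j X φ = (t s.init).R j X φ) ∧
        (∀ j, j ≤ k → ∀ X φ a, (tT s).B j X φ a = (t s.init).B j X φ a))
    (hnoR : ∀ s : SeqOfRecord F θ.ν θ.τ9.M (gOfRecord₁₃ F N θ.toStage13Params p) p.K (k + 1), s.Ω (k + 1) = ∅ → ∀ X φ, (tT s).R (k + 1) X φ = 0)
    (hnoB : ∀ s : SeqOfRecord F θ.ν θ.τ9.M (gOfRecord₁₃ F N θ.toStage13Params p) p.K (k + 1), s.Ω (k + 1) = ∅ → ∀ X φ a, (tT s).B (k + 1) X φ a = 0)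
    (hlocE : ∀ s : SeqOfRecord F θ.ν θ.τ9.M (gOfRecord₁₃ F N θ.toStage13Params p) p.K (k + 1), s.Ω (k + 1) = ∅ → ∀ X z g φ ψ,
      (sect2TowerOfRecord F N (FluctV N) p.K (settingOfRecord₁₃ F N θ.toStage13Params p) (θ.rzAt p s) s (tT s)).agreeOn (k + 1) X φ ψ →
        (tT s).E (k + 1) X z g φ = (tT s).E (k + 1) X z g ψ)
    (hinvE : ∀ s : SeqOfRecord F θ.ν θ.τ9.M (gOfRecord₁₃ F N θ.toStage13Params p) p.K (k + 1), s.Ω (k + 1) = ∅ → ∀ X z g u φ,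
      (tT s).E (k + 1) X z g ((sect2TowerOfRecord F N (FluctV N) p.K (settingOfRecord₁₃ F N θ.toStage13Params p) (θ.rzAt p s) s (tT s)).act u φ) = (tT s).E (k + 1) X z g φ)
    (hbdE : ∀ s : SeqOfRecord F θ.ν θ.τ9.M (gOfRecord₁₃ F N θ.toStage13Params p) p.K (k + 1), s.Ω (k + 1) = ∅ → ∀ X z g φ, 0 ≤ g →
      g ≤ (settingOfRecord₁₃ F N θ.toStage13Params p).lf.γ →
      φ ∈ (sect2TowerOfRecord F N (FluctV N) p.K (settingOfRecord₁₃ F N θ.toStage13Params p) (θ.rzAt p s) s (tT s)).space (k + 1) X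
        ((settingOfRecord₁₃ F N θ.toStage13Params p).lf.alpha0 ((settingOfRecord₁₃ F N θ.toStage13Params p).flow.g (k + 1)))
        ((settingOfRecord₁₃ F N θ.toStage13Params p).lf.alpha1 ((settingOfRecord₁₃ F N θ.toStage13Params p).flow.g (k + 1))) →
      ‖(tT s).E (k + 1) X z g φ‖ ≤ (settingOfRecord₁₃ F N θ.toStage13Params p).lf.E₀ *
        Real.exp (-((1 + 4 * (settingOfRecord₁₃ F N θ.toStage13Params p).βc) * (settingOfRecord₁₃ F N θ.toStage13Params p).lf.κ) *
          (Sect2.domSys (F.P p.K) θ.τ9.M (k + 1)).dj X))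
    (hanE : ∀ s : SeqOfRecord F θ.ν θ.τ9.M (gOfRecord₁₃ F N θ.toStage13Params p) p.K (k + 1), s.Ω (k + 1) = ∅ → ∀ X z g, 0 ≤ g →
      g ≤ (settingOfRecord₁₃ F N θ.toStage13Params p).lf.γ →
      AnalyticOnNhd ℂ ((tT s).E (k + 1) X z g)
        ((sect2TowerOfRecord F N (FluctV N) p.K (settingOfRecord₁₃ F N θ.toStage13Params p) (θ.rzAt p s) s (tT s)).space (k + 1) X
          ((settingOfRecord₁₃ F N θ.toStage13Params p).lf.alpha0 ((settingOfRecord₁₃ F N θ.toStage13Params p).flow.g (k + 1)))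
          ((settingOfRecord₁₃ F N θ.toStage13Params p).lf.alpha1 ((settingOfRecord₁₃ F N θ.toStage13Params p).flow.g (k + 1)))))
    (hEk : ∀ s : SeqOfRecord F θ.ν θ.τ9.M (gOfRecord₁₃ F N θ.toStage13Params p) p.K (k + 1), s.Ω (k + 1) = ∅ → EkT s = Ek s.init)
    (hA : ∀ s : SeqOfRecord F θ.ν θ.τ9.M (gOfRecord₁₃ F N θ.toStage13Params p) p.K (k + 1), s.Ω (k + 1) = ∅ →
      ∀ (S : ℕ → Set (Site (F.P p.K) 0)) (a a' : Tk.MSFluct (F.P p.K) (FluctV N)) (Uf : GaugeField (F.P p.K) 0 (SU N)), (∀ i, i ≤ k → a i = a' i) →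
      (sect2ActionDataOfRecord F N (FluctV N) p.K (settingOfRecord₁₃ F N θ.toStage13Params p) (θ.rzAt p s.init) s.init (t s.init) (S, a) (Ek s.init)).action23 k Uf =
        (sect2ActionDataOfRecord F N (FluctV N) p.K (settingOfRecord₁₃ F N θ.toStage13Params p) (θ.rzAt p s.init) s.init (t s.init) (S, a') (Ek s.init)).action23 k Uf)
    (hmB : ∀ s : SeqOfRecord F θ.ν θ.τ9.M (gOfRecord₁₃ F N θ.toStage13Params p) p.K (k + 1), s.Ω (k + 1) = ∅ →
      ∀ S ∈ admSOfRecord F θ.ν θ.τ9.M (gOfRecord₁₃ F N θ.toStage13Params p) p.K k s.init,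
      Measurable fun U₀ : GaugeField (F.P p.K) k (SU N) =>
        tkBranchOfRecord F N (FluctV N) θ.ν θ.τ9.M _ p.K (WtOfRecord₁₃H F N (rePinH θ) p s) s.init S k
          (fun ω => sect2Operand F N (FluctV N) p.K (settingOfRecord₁₃ F N θ.toStage13Params p) (θ.rzAt p s.init) s.init (t s.init) (Ek s.init)
            (UbgOfRecord₁₃CoP F N θ.toStage13Params p k s.init) (S, fun j => (ω j).2) (fun j => (ω j).1))
          (baseCfg (V := FluctV N) k U₀))
    (hIB : ∀ s : SeqOfRecord F θ.ν θ.τ9.M (gOfRecord₁₃ F N θ.toStage13Params p) p.K (k + 1), s.Ω (k + 1) = ∅ →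
      ∀ S ∈ admSOfRecord F θ.ν θ.τ9.M (gOfRecord₁₃ F N θ.toStage13Params p) p.K k s.init,
      Integrable (fun U₀ : GaugeField (F.P p.K) k (SU N) =>
        tkBranchOfRecord F N (FluctV N) θ.ν θ.τ9.M _ p.K (WtOfRecord₁₃H F N (rePinH θ) p s) s.init S k
          (fun ω => sect2Operand F N (FluctV N) p.K (settingOfRecord₁₃ F N θ.toStage13Params p) (θ.rzAt p s.init) s.init (t s.init) (Ek s.init)
            (UbgOfRecord₁₃CoP F N θ.toStage13Params p k s.init) (S, fun j => (ω j).2) (fun j => (ω j).1))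
          (baseCfg (V := FluctV N) k U₀)) (fieldMeasure (F.P p.K) k (SU N)))
    (hexp : ∀ s : SeqOfRecord F θ.ν θ.τ9.M (gOfRecord₁₃ F N θ.toStage13Params p) p.K (k + 1), s.Ω (k + 1) ≠ ∅ →
      Sect2.LawsT (sect2TowerOfRecord F N (FluctV N) p.K (settingOfRecord₁₃ F N θ.toStage13Params p) (θ.rzAt p s) s (tT s))
          (settingOfRecord₁₃ F N θ.toStage13Params p).lf (settingOfRecord₁₃ F N θ.toStage13Params p).βc k ∧
        (slotsTOfRecord F N θ.ν θ.τ9 (EOfRecord₁₃ F N θ.toStage13Params) (wOfRecord₉ F N θ.toStage9Params) θ.ppSel p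
            (gOfRecord₁₃ F N θ.toStage13Params p) (k + 1) s = 0 ∨
          ∀ᵐ V' ∂fieldMeasure (F.P p.K) (k + 1) (SU N),
            chiSeqOfRecord F N θ.ν θ.τ9.M (gOfRecord₁₃ F N θ.toStage13Params p) p.K (k + 1) s V' ≠ 0 →
              slotsTOfRecord F N θ.ν θ.τ9 (EOfRecord₁₃ F N θ.toStage13Params) (wOfRecord₉ F N θ.toStage9Params) θ.ppSel p
                  (gOfRecord₁₃ F N θ.toStage13Params p) (k + 1) s V' =
                sect2Slot F N (FluctV N) p.K (settingOfRecord₁₃ F N θ.toStage13Params p) (θ.rzAt p s) (WtOfRecord₁₃H F N (rePinH θ) p s) s (tT s) (EkT s)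
                  (UbgOfRecord₁₃CoP F N θ.toStage13Params p (k + 1) s) V')) :
    SLaw₁₃CoPH F N (rePinH θ) p (k + 1) :=
  sLaw₁₃CoPH_succ_of_formAtZS_of_newTerms_of_expansion_of_liveSel_of_integrable (rePinH θ) p (provisos₁₃CoPH_rePinH h) hsel hθ hκ hE₀ hB₀ hk hM t Ek hS tT EkT huT
    hold hnoR hnoB hlocE hinvE hbdE hanE hEk (fun _ _ _ _ _ _ _ => rfl) (fun s hΩ => prefix_agree_rePinH θ p s hΩ) hA
    (fun s hΩ => zhAt_rePinH_ζ0_univ_pairCfgAt θ p hk s hΩ) (fun _ _ _ _ => rfl) hmB hIB hexp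

end Reduction

end Summit.QuantumFields.YangMills.Theorems.BalabanUVNodesN11NoExpansionStepReductionRePinnedIntegrableCoPH

end
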